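import Literature.MathematicalPhysics.QuantumFieldTheory.Balaban1983to89.B9Eq3130TransferPairDifference
import Literature.MathematicalPhysics.QuantumFieldTheory.Balaban1983to89.B9Eq3130GtildePairRowsClosedTower

/-!
# `Balaban1983to89.B9Eq3130GtildeMinusG1kRowsClosed` — T. Bałaban, *Propagators for lattice gauge theories in a background field*, Commun. Math. Phys. **99** (1985)
# 389–434 [Balaban1985BackgroundPropagators] (3.130)–(3.131) pp. 421–422 (*«G = G₀(I − Δ′_πG₀)⁻¹ = Σ G₀(Δ′_πG₀)ⁿ»*; p. 422 *«The operators (QGQ*)⁻¹, or (QG₁Q*)⁻¹, can be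
# analyzed in the same way as the operator (Q′G′²Q′*)⁻¹»*), (3.117) p. 419, (3.36) p. 396: **THE DIFFERENCE `G̃_k − G1k` ON THE CELL's MODEL HAS ONE-SIDED LETTERS OF
# SIZE `j₀` (value row, divergence row), ∃-FIRST, HEIGHT-FREE** — the brick `E = Q_k(G̃_k − G1k)Q_k†` of the NE9 owner's RULING R-ne9p1-g97-4 (2)(b) (journal l.66556)

statement-level skeleton of published theorems with citation tags; proofs where landed; nothing here is a claim about the Yang–Mills mass gap

CITATION HEADER (lean-in-tree rule).  Audit cell `pub-balaban`, sub-cell `t4`, BINDER row NE9; NE9 crux-team LEAF PROVER 05 (`b2b-balaban-t4-ne9-formalise-leaf-05`, gen 88;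
(K79)).  Composed BY NAME: (K78) `transfer_pair_diff` at `G₀ := G1k`, `G̃ := G1LatticeK hposπ`, with (K77) `exists_local_letters_G1LatticeKPi` (the CLOSED rows of `G̃_k`) in
the a-priori slot, coefficient letters (K64) `exists_local_letter_G1k`, (DGK) `exists_divergence_row_G1k`, (K76a) `exists_local_letters_GpOfUk_RofUk`, (K70)
`exists_local_gradLetter_GpRk`, (K75) `local_hessOp_covDerivL2K_tower` ∕ `local_covDivL2K_hessOp_tower`, identities (HSD) `G1kPi_resolvent_stencils`, (BHG)
`G1k_covDerivL2K_RofUk` ∕ `covDivL2K_covDerivL2K_GpOfUk_RofUk` (ne9-leaf-03 g80).  Source READ first-hand (`paper:balaban1985-cmp99-background-propagators`, PDF + 388):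
pp. 396, 419–422, 426.  [folklore] assembly; NOTHING of print's (3.36) ∕ (3.130)–(3.133) ∕ Thm 3.3 ∕ 3.13 is asserted, valued or discharged.
WHAT IS PROVED (sorry-free; no `def`).  **`exists_local_letters_G1LatticeKPi_sub_G1k`**: `∃ (α₁, j₁, C, δ)` BEFORE (K77)'s binder block VERBATIM such that for block-supported `f`
with `‖f‖_∞ ≤ F`: `‖((G̃_k − G1k)f)(b)‖ ≤ j₀·C·e^{−δ·d_m(Π(b₋), v)}·F` and `‖(D*_U(G̃_kf) − D*_U(G1kf))(y)‖ ≤ j₀·C·e^{−δ·d_m(Πy, v)}·F` — `δ = κ∕2`, `κ = min` of the five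
suppliers' rates, `C = (A₁ + A₂ + A₃ + A₄)·B_T` (`A_i` = the `j₀`-coefficients of (K72)'s `q₁ = j₀A₁ + j₀²A₂`, `q₂ = j₀A₃ + j₀²A₄`; `B_T` = (K77)'s constant),
`j₁ = min(1, j₁(K77))`, `α₁ = min` of the five radii.
HONEST SCOPE.  `hpos′`, `hpos`, `hposπ`, the windows, E162's data, `c₀ = η^d`, `‖J‖ ≤ j₀` stay HYPOTHESES; constants crude; «NE9 ⇐ the named binders»; NE9 NOT PRINTED ∕
NOT PROVED; row WALLED ON A MODEL (O-NE9-1; #5 UNRULED); spine PROVED 0∕9; rung (B)+1 on a finite T⁴ — NOT infinite volume, NOT mass gap, NOT BetaPertH, NOT Clay.  HONEST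
DEPENDENCY: continuum YM on T⁴ ⇐ BetaPertH ∧ nine spine estimates (0/9 proved); BetaPertH ⇐ (D1) ∧ (D4) ∧ CAP+tail; G-an2-4 gates asym, D1 and NE2/3/4.  NEW file
importing (K78) and (K77); nothing modified.  Net new unproved facts: 0.
-/


noncomputable section

set_option autoImplicit false

open scoped InnerProductSpace ComplexConjugate BigOperators

namespace Literature.MathematicalPhysics.QuantumFieldTheory.Balaban1983to89.B9Eq3130GtildeMinusG1kRowsClosed

open B4Sect5Torus (TSite tdist tdist_nonneg tdist_symm tdist_self tdist_triangle torusSum_le)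
open B4Sect5Proof (latticeConst latticeConst_nonneg)
open B9SectCLatticeCarrier (Bond DirPair bpos btgt shift unshift)
open B9Eq311L2Pairing (WL2)
open B9Eq319QprimeTorus (fineP blockCoord)
open B7Prop1Explicit (U1 Wcx boxVec)
open B11Eq103H1Complex (SiteL2K BondL2K greenK covDerivL2K covDivL2K G1LatticeK)
open B9Eq310DeltaPrime (plaqHolU)
open B9Eq310HessianOperator (adTransportW hessOp)
open B9Eq310HessianHermitian (adTransportW_adjoint)
open B9Eq315QTorus (perCfg cornerSite)
open B9Eq315QTower (towerP UlevOf)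
open B9Eq316TowerFlatIsOneStep (towerP_eq_fineP_pow siteCast)
open B9Eq326OperatorTower (QprimeTowerW RofUk laplaceAk G1k)
open B9Eq324DeltaPrimeATower (laplacePrimeAk GpOfUk)
open B9Eq33CovDerivLocalLetterTower (tdist_bigBlock_bpos_btgt_le_one)
open B9Eq326G1kSupRowClosed (exists_local_letter_G1k)
open B9Eq326G1kDivergenceRowClosed (exists_divergence_row_G1k)
open B9Eq325RofUkSupRowClosed (exists_local_letters_GpOfUk_RofUk)
open B9Eq3152GreenPrimeProjGradRowClosed (exists_local_gradLetter_GpRk)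
open B9Eq3117GaugeModeStencilLettersTower (local_hessOp_covDerivL2K_tower local_covDivL2K_hessOp_tower)
open B9Eq3130TransferPairDifference (transfer_pair_diff)
open B9Eq3130GtildePairRowsClosedTower (exists_local_letters_G1LatticeKPi)
open B9Eq3119DeltaPiTower (piOfUk laplaceAkPi)
open B9Eq3130HessianSlotDifferenceTower (G1kPi_resolvent_stencils)
open B9Eq3152BareHessianGaugeModeTower (G1k_covDerivL2K_RofUk covDivL2K_covDerivL2K_GpOfUk_RofUk)

variable {d : ℕ} (hd : 1 ≤ d) (L : ℕ) [NeZero L] (hL : 1 ≤ L) (hL3 : 3 ≤ L)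
  {𝔸 : Type*} [NormedRing 𝔸] [NormedAlgebra ℂ 𝔸] [CompleteSpace 𝔸] [NormOneClass 𝔸] [StarRing 𝔸] [NormedStarGroup 𝔸] [StarModule ℂ 𝔸]
  {W : Type*} [NormedAddCommGroup W] [InnerProductSpace ℂ W] [FiniteDimensional ℂ W] (φ : W ≃ₗ[ℂ] 𝔸)
  {Mφ Mφ' : ℝ} (hMφ : 0 ≤ Mφ) (hMφ' : 0 ≤ Mφ') (hφ : ∀ w, ‖φ w‖ ≤ Mφ * ‖w‖) (hφ' : ∀ X, ‖φ.symm X‖ ≤ Mφ' * ‖X‖) (hstar : ∀ X : 𝔸, ‖star X‖ ≤ ‖X‖)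
  {a : ℝ} (ha : 0 < a) {a' : ℝ} (ha' : 0 < a') {ϱ : ℝ} (hϱ0 : 0 ≤ ϱ) (hϱ1 : ϱ < 1)
  (τ : 𝔸 →ₗ[ℂ] ℂ) {Cτ : ℝ} (hτ : ∀ X, ‖τ X‖ ≤ Cτ * ‖X‖) (hCτ : 0 ≤ Cτ) {Mτ : ℝ} (hτm : ∀ X Y : 𝔸, ‖τ (X * Y)‖ ≤ Mτ * ‖X‖ * ‖Y‖) (hMτ : 0 ≤ Mτ)
  {ρw : ℝ} (hρw : 0 ≤ ρw)
  (hτ₁ : ∀ X : 𝔸, τ (star X) = conj (τ X)) (hτ₂ : ∀ X Y : 𝔸, τ (X * Y) = τ (Y * X)) (hφτ : ∀ X Y : 𝔸, ⟪φ.symm X, φ.symm Y⟫_ℂ = τ (star X * Y))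
  (AQ : ℝ)

omit [NeZero L] in
/-- `e^{−r t} ≤ e^{−κ t}` for `κ ≤ r`, `0 ≤ t`. [folklore] -/
private theorem exp_weaken' {r κ t : ℝ} (hκ : κ ≤ r) (ht : 0 ≤ t) : Real.exp (-(r * t)) ≤ Real.exp (-(κ * t)) :=
  Real.exp_le_exp.2 (by nlinarith)

omit [NeZero L] in
/-- `e^{−κ t′} ≤ e^{κ}·e^{−κ t}` when `t ≤ t′ + 1`, `0 ≤ κ` (a gradient row read at the bond's tip block is read at its base block). [folklore] -/
private theorem exp_reblock {κ t t' : ℝ} (hκ : 0 ≤ κ) (h : t ≤ t' + 1) : Real.exp (-(κ * t')) ≤ Real.exp κ * Real.exp (-(κ * t)) := by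
  rw [← Real.exp_add]
  exact Real.exp_le_exp.2 (by nlinarith [mul_le_mul_of_nonneg_left h hκ])

set_option maxHeartbeats 400000 in -- five `∃`-first suppliers (≈ 45 binders each) + the three identities + (K78)'s 40-binder call: the final assembly exceeds the default budget by a small margin (as (K64)∕(E2) in this directory)
include hd hL hL3 hMφ hMφ' hφ hφ' hstar ha ha' hϱ0 hϱ1 hτ hCτ hτm hMτ hρw hτ₁ hτ₂ hφτ in
/-- **THE DIFFERENCE `G̃_k − G1k` IS `O(j₀)` IN THE ONE-SIDED LETTER CURRENCY (value row and divergence row, ∃-first, height-free)** — (K78)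
`transfer_pair_diff` at `G₀ := G1k`, `G̃ := G1LatticeK hposπ` (CLMs), identities by (HSD)∕(BHG), coefficient letters (K64)(DGK)(K76a)(K70)(K75) at the common
rate `κ`, a-priori letters = (K77)'s CLOSED rows of `G̃_k` weakened to `κ∕2`; then `q_i·B_T = (j₀A + j₀²A′)B_T ≤ j₀·(A₁+A₂+A₃+A₄)·B_T` for `j₀ ≤ 1`.
[cite: Balaban1985BackgroundPropagators, (3.130)–(3.131) pp.421–422, (3.117) p.419, (3.36) p.396, (3.152) p.426] [cite: Balaban1984PropagatorsII, Lemma 2.1 (2.61) p.234] -/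
theorem exists_local_letters_G1LatticeKPi_sub_G1k :
    ∃ α₁ j₁ C δ : ℝ, 0 < α₁ ∧ 0 < j₁ ∧ 0 ≤ C ∧ 0 < δ ∧
      ∀ (n : ℕ) (η : ℝ) (_hηL : η * (L : ℝ) ^ (n + 1) = 1) (c₀ c₁ : ℝ) [Fact (0 < c₀)] [Fact (0 < c₁)]
        (_hw : c₀ * ((L : ℝ) ^ (n + 1)) ^ d = c₁) (_hρ : |η| ^ d / c₀ ≤ ρw) (m : Fin d → ℕ) [∀ i, NeZero (m i)] (_hm : ∀ i, 1 ≤ m i)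
        (U : Bond d (towerP L m (n + 1)) → 𝔸ˣ) (αU : ℕ → ℝ) (_hα0 : ∀ j, 0 ≤ αU j) (hα1 : ∀ j, αU j ≤ 1 / 64)
        (hU1 : ∀ (j : ℕ) (x : B7Prop1Explicit.Site d) (k : Fin d), perCfg (towerP L m (j + 1)) (UlevOf L m (n + 1) U j) x k ∈ U1 𝔸)
        (hreg : ∀ (j : ℕ) (y : TSite d (towerP L m j)) (k : Fin d) (ρ' : Fin d → Fin L),
          ‖((Wcx L (perCfg (towerP L m (j + 1)) (UlevOf L m (n + 1) U j)) (cornerSite L y) k (boxVec L ρ') : 𝔸ˣ) : 𝔸) - 1‖ ≤ αU j)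
        (εU : ℕ → ℝ) (_hεU : ∀ j, 0 ≤ εU j) (_hUε : ∀ (j : ℕ) (b : Bond d (towerP L m (j + 1))), ‖(UlevOf L m (n + 1) U j b : 𝔸) - 1‖ ≤ εU j)
        (_hLb : ∀ (j : ℕ) (b : Bond d (towerP L m (j + 1))), UlevOf L m (n + 1) U j b ∈ U1 𝔸)
        (α : ℝ) (_hα : 0 ≤ α) (_hαle : α ≤ α₁)
        (hUst : ∀ b, star (U b : 𝔸) = (((U b)⁻¹ : 𝔸ˣ) : 𝔸)) (_hUb : ∀ b, U b ∈ U1 𝔸) (_hUη : ∀ b, ‖(U b : 𝔸) - 1‖ ≤ α * η)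
        (_hpl : ∀ p : B9SectCLatticeCarrier.Plaq d (towerP L m (n + 1)), ‖(plaqHolU U p : 𝔸) - 1‖ ≤ α * η ^ 2)
        (_hUgrad : ∀ (x : TSite d (towerP L m (n + 1))) (μ : Fin d), ‖(U (x, μ) : 𝔸) - U (unshift μ x, μ)‖ ≤ α * η ^ 2)
        (_hRlev : ∀ (j : ℕ) (b : Bond d (towerP L m (j + 1))) (w : W), ‖adTransportW φ (UlevOf L m (n + 1) U j) b w‖ ≤ ‖w‖)
        (_hεg : ∀ j < n + 1, εU j ≤ α * ϱ ^ j) (_hAQ : ∑ j ∈ Finset.range (n + 1), αU j ≤ AQ)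
        (hpos' : ∀ x : SiteL2K ℂ d (towerP L m (n + 1)) c₀ W, x ≠ 0 → 0 < RCLike.re ⟪x, laplacePrimeAk L m n φ η U a' (c₁ := c₁) x⟫_ℂ)
        (hpos : ∀ x : BondL2K ℂ d (towerP L m (n + 1)) c₀ W, x ≠ 0 →
          0 < RCLike.re ⟪x, laplaceAk L m n φ η U hL αU hα1 hU1 hreg τ (c₀ := c₀) (c₁ := c₁) a x⟫_ℂ)
        (_hc₀η : c₀ = η ^ d) (j₀ : ℝ) (_hJ : ∀ μ y, ‖B9Eq39Adjoint.J (fun μ => B9Eq33CovDerivVector.shiftEquiv μ) (fun μ y => U (y, μ)) η μ y‖ ≤ j₀) (_hj : j₀ ≤ j₁)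
        (hposπ : ∀ x : BondL2K ℂ d (towerP L m (n + 1)) c₀ W, x ≠ 0 →
          0 < RCLike.re ⟪x, laplaceAkPi L m n φ τ η U a' hpos' hL αU hα1 hU1 hreg (c₁ := c₁) a x⟫_ℂ)
        (v : TSite d m) (f : BondL2K ℂ d (towerP L m (n + 1)) c₀ W) (F : ℝ)
        (_hfv : ∀ b, blockCoord (L ^ (n + 1)) m (siteCast (towerP_eq_fineP_pow L m (n + 1)) (bpos b)) ≠ v →
          WL2.equiv ℂ (fun _ : Bond d (towerP L m (n + 1)) => c₀) W f b = 0)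
        (_hfF : ∀ b, ‖WL2.equiv ℂ (fun _ : Bond d (towerP L m (n + 1)) => c₀) W f b‖ ≤ F) (b : Bond d (towerP L m (n + 1))) (y : TSite d (towerP L m (n + 1))),
        ‖WL2.equiv ℂ (fun _ : Bond d (towerP L m (n + 1)) => c₀) W (G1LatticeK hposπ f - G1k L m n φ η U hL αU hα1 hU1 hreg τ (c₀ := c₀) (c₁ := c₁) hpos f) b‖ ≤
            j₀ * C * Real.exp (-(δ * tdist m (blockCoord (L ^ (n + 1)) m (siteCast (towerP_eq_fineP_pow L m (n + 1)) (bpos b))) v)) * F ∧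
          ‖WL2.equiv ℂ (fun _ : TSite d (towerP L m (n + 1)) => c₀) W
              (covDivL2K ℂ c₀ ((η : ℂ))⁻¹ (adTransportW φ fun bb => (U bb)⁻¹) (G1LatticeK hposπ f) - covDivL2K ℂ c₀ ((η : ℂ))⁻¹ (adTransportW φ fun bb => (U bb)⁻¹) (G1k L m n φ η U hL αU hα1 hU1 hreg τ (c₀ := c₀) (c₁ := c₁) hpos f)) y‖ ≤
            j₀ * C * Real.exp (-(δ * tdist m (blockCoord (L ^ (n + 1)) m (siteCast (towerP_eq_fineP_pow L m (n + 1)) y)) v)) * F := by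
  classical
  obtain ⟨αK, BK, δK, hαK, hBK, hδK, HK⟩ :=
    exists_local_letter_G1k hd L hL hL3 φ hMφ hMφ' hφ hφ' hstar ha ha' hϱ0 hϱ1 τ hτ hCτ hτm hMτ hρw hτ₁ hτ₂ hφτ AQ
  obtain ⟨αG, BG1, δG, hαG, hBG1, hδG, HG⟩ :=
    exists_divergence_row_G1k hd L hL hL3 φ hMφ hMφ' hφ hφ' hstar ha ha' hϱ0 hϱ1 τ hτ hCτ hτm hMτ hρw hτ₁ hτ₂ hφτ AQ
  obtain ⟨αR, BR, δR, hαR, hBR, hδR, HR⟩ :=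
    exists_local_letters_GpOfUk_RofUk hd L hL hL3 φ hMφ hMφ' hφ hφ' ha ha' hϱ0 hϱ1 τ hτ hCτ hMτ hρw hτ₁ hτ₂ hφτ AQ
  obtain ⟨αD, BD, δD, hαD, hBD, hδD, HD⟩ :=
    exists_local_gradLetter_GpRk hd L hL hL3 φ hMφ hMφ' hφ hφ' ha ha' hϱ0 hϱ1 τ hτ hCτ hMτ hρw hτ₁ hτ₂ hφτ AQ
  obtain ⟨αT, jT, BT, δT, hαT, hjT, hBT, hδT, HT⟩ :=
    exists_local_letters_G1LatticeKPi hd L hL hL3 φ hMφ hMφ' hφ hφ' hstar ha ha' hϱ0 hϱ1 τ hτ hCτ hτm hMτ hρw hτ₁ hτ₂ hφτ AQ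
  obtain ⟨κ, hκdef⟩ : ∃ κ : ℝ, κ = min (min (min δK δG) (min δR δD)) δT := ⟨_, rfl⟩
  have hκ0 : 0 < κ := by rw [hκdef]; exact lt_min (lt_min (lt_min hδK hδG) (lt_min hδR hδD)) hδT
  have hκK : κ ≤ δK := by rw [hκdef]; exact ((min_le_left _ _).trans (min_le_left _ _)).trans (min_le_left _ _)
  have hκG : κ ≤ δG := by rw [hκdef]; exact ((min_le_left _ _).trans (min_le_left _ _)).trans (min_le_right _ _)
  have hκR : κ ≤ δR := by rw [hκdef]; exact ((min_le_left _ _).trans (min_le_right _ _)).trans (min_le_left _ _)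
  have hκD : κ ≤ δD := by rw [hκdef]; exact ((min_le_left _ _).trans (min_le_right _ _)).trans (min_le_right _ _)
  have hκT : κ ≤ δT := by rw [hκdef]; exact min_le_right _ _
  have hκT2 : κ / 2 ≤ δT := (half_le_self hκ0.le).trans hκT
  obtain ⟨K, hKdef⟩ : ∃ K : ℝ, K = latticeConst d (κ - κ / 2) := ⟨_, rfl⟩
  have hK0 : 0 ≤ K := by rw [hKdef]; exact latticeConst_nonneg d (sub_pos.2 (half_lt_self hκ0)).le
  obtain ⟨e1, he1⟩ : ∃ e1 : ℝ, e1 = 2 * Mφ * Mφ' * Real.exp κ := ⟨_, rfl⟩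
  obtain ⟨e2, he2⟩ : ∃ e2 : ℝ, e2 = 2 * (d : ℝ) * Mφ * Mφ' * Real.exp κ := ⟨_, rfl⟩
  have he1_0 : 0 ≤ e1 := by rw [he1]; positivity
  have he2_0 : 0 ≤ e2 := by rw [he2]; positivity
  obtain ⟨BDb, hBDb⟩ : ∃ BDb : ℝ, BDb = BD * Real.exp κ := ⟨_, rfl⟩
  have hBDb0 : 0 ≤ BDb := by rw [hBDb]; positivity
  obtain ⟨A₁, hA₁⟩ : ∃ A₁ : ℝ, A₁ = BR * K * BR * K * e1 * K * BK * K + e2 * K * BR * K * BDb * K + BDb * K * e2 * K * BR * K * BDb * K := ⟨_, rfl⟩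
  obtain ⟨A₂, hA₂⟩ : ∃ A₂ : ℝ, A₂ = e2 * K * BR * K * BR * K * BR * K * e1 * K * BK * K + BDb * K * e2 * K * BR * K * BR * K * BR * K * e1 * K * BK * K :=
    ⟨_, rfl⟩
  obtain ⟨A₃, hA₃⟩ : ∃ A₃ : ℝ, A₃ = BR * K * BR * K * e1 * K * BG1 * K + e2 * K * BR * K * BR * K + BDb * K * e2 * K * BR * K * BR * K := ⟨_, rfl⟩
  obtain ⟨A₄, hA₄⟩ : ∃ A₄ : ℝ, A₄ = e2 * K * BR * K * BR * K * BR * K * e1 * K * BG1 * K + BDb * K * e2 * K * BR * K * BR * K * BR * K * e1 * K * BG1 * K :=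
    ⟨_, rfl⟩
  have hA₁0 : 0 ≤ A₁ := by rw [hA₁]; positivity
  have hA₂0 : 0 ≤ A₂ := by rw [hA₂]; positivity
  have hA₃0 : 0 ≤ A₃ := by rw [hA₃]; positivity
  have hA₄0 : 0 ≤ A₄ := by rw [hA₄]; positivity
  obtain ⟨C, hC⟩ : ∃ C : ℝ, C = (A₁ + A₂ + A₃ + A₄) * BT := ⟨_, rfl⟩
  have hC0 : 0 ≤ C := by rw [hC]; positivity
  obtain ⟨j₁, hj₁⟩ : ∃ j₁ : ℝ, j₁ = min 1 jT := ⟨_, rfl⟩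
  have hj₁0 : 0 < j₁ := by rw [hj₁]; exact lt_min one_pos hjT
  have hj₁1 : j₁ ≤ 1 := by rw [hj₁]; exact min_le_left _ _
  have hj₁T : j₁ ≤ jT := by rw [hj₁]; exact min_le_right _ _
  obtain ⟨αs, hαs⟩ : ∃ αs : ℝ, αs = min (min (min αK αG) (min αR αD)) αT := ⟨_, rfl⟩
  have hαs0 : 0 < αs := by rw [hαs]; exact lt_min (lt_min (lt_min hαK hαG) (lt_min hαR hαD)) hαT
  refine ⟨αs, j₁, C, κ / 2, hαs0, hj₁0, hC0, half_pos hκ0, ?_⟩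
  intro n η hηL c₀ c₁ _ _ hw hρ m _ hm U αU hα0 hα1 hU1 hreg εU hεU hUε hLb α hα hαle hUst hUb hUη hpl hUgrad hRlev hεg hAQ hpos' hpos hc₀η j₀ hJ hj
    hposπ v f F hfv hfF b y
  haveI : Nonempty (Bond d (towerP L m (n + 1))) := ⟨b⟩
  have hF0 : 0 ≤ F := (norm_nonneg _).trans (hfF b)
  have hη : η ≠ 0 := by
    intro h0; rw [h0, zero_mul] at hηL; exact zero_ne_one hηL
  have hj₀0 : 0 ≤ j₀ := (norm_nonneg _).trans (hJ b.2 b.1)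
  have hj₀1 : j₀ ≤ 1 := hj.trans hj₁1
  have hαK_ : α ≤ αK := hαle.trans (by rw [hαs]; exact ((min_le_left _ _).trans (min_le_left _ _)).trans (min_le_left _ _))
  have hαG_ : α ≤ αG := hαle.trans (by rw [hαs]; exact ((min_le_left _ _).trans (min_le_left _ _)).trans (min_le_right _ _))
  have hαR_ : α ≤ αR := hαle.trans (by rw [hαs]; exact ((min_le_left _ _).trans (min_le_right _ _)).trans (min_le_left _ _))
  have hαD_ : α ≤ αD := hαle.trans (by rw [hαs]; exact ((min_le_left _ _).trans (min_le_right _ _)).trans (min_le_right _ _))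
  have hαT_ : α ≤ αT := hαle.trans (by rw [hαs]; exact min_le_right _ _)
  have hjT_ : j₀ ≤ jT := hj.trans hj₁T
  obtain ⟨G0cl, hG0cl⟩ : ∃ T : BondL2K ℂ d (towerP L m (n + 1)) c₀ W →L[ℂ] BondL2K ℂ d (towerP L m (n + 1)) c₀ W,
      T = LinearMap.toContinuousLinearMap (G1k L m n φ η U hL αU hα1 hU1 hreg τ (c₀ := c₀) (c₁ := c₁) hpos) := ⟨_, rfl⟩
  obtain ⟨Dcl, hDcl⟩ : ∃ T : SiteL2K ℂ d (towerP L m (n + 1)) c₀ W →L[ℂ] BondL2K ℂ d (towerP L m (n + 1)) c₀ W,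
      T = LinearMap.toContinuousLinearMap (covDerivL2K ℂ c₀ ((η : ℂ))⁻¹ (adTransportW φ U)) := ⟨_, rfl⟩
  obtain ⟨Dscl, hDscl⟩ : ∃ T : BondL2K ℂ d (towerP L m (n + 1)) c₀ W →L[ℂ] SiteL2K ℂ d (towerP L m (n + 1)) c₀ W,
      T = LinearMap.toContinuousLinearMap (covDivL2K ℂ c₀ ((η : ℂ))⁻¹ (adTransportW φ fun bb => (U bb)⁻¹)) := ⟨_, rfl⟩
  obtain ⟨Mcl, hMcl⟩ : ∃ T : SiteL2K ℂ d (towerP L m (n + 1)) c₀ W →L[ℂ] BondL2K ℂ d (towerP L m (n + 1)) c₀ W,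
      T = LinearMap.toContinuousLinearMap (hessOp φ η U τ ∘ₗ covDerivL2K ℂ c₀ ((η : ℂ))⁻¹ (adTransportW φ U)) := ⟨_, rfl⟩
  obtain ⟨Mtcl, hMtcl⟩ : ∃ T : BondL2K ℂ d (towerP L m (n + 1)) c₀ W →L[ℂ] SiteL2K ℂ d (towerP L m (n + 1)) c₀ W,
      T = LinearMap.toContinuousLinearMap (covDivL2K ℂ c₀ ((η : ℂ))⁻¹ (adTransportW φ fun bb => (U bb)⁻¹) ∘ₗ hessOp φ η U τ) := ⟨_, rfl⟩
  obtain ⟨Gpcl, hGpcl⟩ : ∃ T : SiteL2K ℂ d (towerP L m (n + 1)) c₀ W →L[ℂ] SiteL2K ℂ d (towerP L m (n + 1)) c₀ W,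
      T = LinearMap.toContinuousLinearMap (GpOfUk L m n φ η U a' (c₁ := c₁) hpos') := ⟨_, rfl⟩
  obtain ⟨Rcl, hRcl⟩ : ∃ T : SiteL2K ℂ d (towerP L m (n + 1)) c₀ W →L[ℂ] SiteL2K ℂ d (towerP L m (n + 1)) c₀ W,
      T = LinearMap.toContinuousLinearMap (RofUk L m n φ η U (c₀ := c₀)) := ⟨_, rfl⟩
  have eG0 : ∀ g, G0cl g = G1k L m n φ η U hL αU hα1 hU1 hreg τ (c₀ := c₀) (c₁ := c₁) hpos g := fun g => by
    rw [hG0cl, LinearMap.coe_toContinuousLinearMap']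
  have eD : ∀ s, Dcl s = covDerivL2K ℂ c₀ ((η : ℂ))⁻¹ (adTransportW φ U) s := fun s => by rw [hDcl, LinearMap.coe_toContinuousLinearMap']
  have eDs : ∀ g, Dscl g = covDivL2K ℂ c₀ ((η : ℂ))⁻¹ (adTransportW φ fun bb => (U bb)⁻¹) g := fun g => by
    rw [hDscl, LinearMap.coe_toContinuousLinearMap']
  have eM : ∀ s, Mcl s = hessOp φ η U τ (covDerivL2K ℂ c₀ ((η : ℂ))⁻¹ (adTransportW φ U) s) := fun s => by
    rw [hMcl, LinearMap.coe_toContinuousLinearMap', LinearMap.comp_apply]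
  have eMt : ∀ g, Mtcl g = covDivL2K ℂ c₀ ((η : ℂ))⁻¹ (adTransportW φ fun bb => (U bb)⁻¹) (hessOp φ η U τ g) := fun g => by
    rw [hMtcl, LinearMap.coe_toContinuousLinearMap', LinearMap.comp_apply]
  have eGp : ∀ s, Gpcl s = GpOfUk L m n φ η U a' (c₁ := c₁) hpos' s := fun s => by rw [hGpcl, LinearMap.coe_toContinuousLinearMap']
  have eR : ∀ s, Rcl s = RofUk L m n φ η U (c₀ := c₀) s := fun s => by rw [hRcl, LinearMap.coe_toContinuousLinearMap']
  obtain ⟨Gt, hGt⟩ : ∃ T : BondL2K ℂ d (towerP L m (n + 1)) c₀ W →L[ℂ] BondL2K ℂ d (towerP L m (n + 1)) c₀ W,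
      T = LinearMap.toContinuousLinearMap (G1LatticeK hposπ) := ⟨_, rfl⟩
  have eGt : ∀ g, Gt g = G1LatticeK hposπ g := fun g => by rw [hGt, LinearMap.coe_toContinuousLinearMap']
  have epi : ∀ w : BondL2K ℂ d (towerP L m (n + 1)) c₀ W, piOfUk L m n φ η U (GpOfUk L m n φ η U a' (c₁ := c₁) hpos') w =
      w - covDerivL2K ℂ c₀ ((η : ℂ))⁻¹ (adTransportW φ U) (GpOfUk L m n φ η U a' (c₁ := c₁) hpos' (RofUk L m n φ η U (c₀ := c₀)
        (covDivL2K ℂ c₀ ((η : ℂ))⁻¹ (adTransportW φ fun bb => (U bb)⁻¹) w))) := fun w => by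
    simp only [piOfUk, LinearMap.sub_apply, LinearMap.id_apply, LinearMap.comp_apply]
  have hT0 : ∀ g, Gt g = G1k L m n φ η U hL αU hα1 hU1 hreg τ (c₀ := c₀) (c₁ := c₁) hpos g
      + G1k L m n φ η U hL αU hα1 hU1 hreg τ (c₀ := c₀) (c₁ := c₁) hpos (hessOp φ η U τ (covDerivL2K ℂ c₀ ((η : ℂ))⁻¹ (adTransportW φ U)
          (GpOfUk L m n φ η U a' (c₁ := c₁) hpos' (RofUk L m n φ η U (c₀ := c₀)
            (covDivL2K ℂ c₀ ((η : ℂ))⁻¹ (adTransportW φ fun bb => (U bb)⁻¹) (Gt g))))))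
      + G1k L m n φ η U hL αU hα1 hU1 hreg τ (c₀ := c₀) (c₁ := c₁) hpos (covDerivL2K ℂ c₀ ((η : ℂ))⁻¹ (adTransportW φ U) (RofUk L m n φ η U (c₀ := c₀)
          (GpOfUk L m n φ η U a' (c₁ := c₁) hpos' (covDivL2K ℂ c₀ ((η : ℂ))⁻¹ (adTransportW φ fun bb => (U bb)⁻¹) (hessOp φ η U τ
            (Gt g - covDerivL2K ℂ c₀ ((η : ℂ))⁻¹ (adTransportW φ U) (GpOfUk L m n φ η U a' (c₁ := c₁) hpos'
              (RofUk L m n φ η U (c₀ := c₀) (covDivL2K ℂ c₀ ((η : ℂ))⁻¹ (adTransportW φ fun bb => (U bb)⁻¹) (Gt g)))))))))) := by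
    intro g
    have h := G1kPi_resolvent_stencils L m n φ τ η U (adTransportW_adjoint φ τ hτ₂ hUst hφτ) a' hpos' hL αU hα1 hU1 hreg a hpos hposπ g
    rw [epi] at h
    rw [eGt]
    exact h
  have h20 : ∀ s, G1k L m n φ η U hL αU hα1 hU1 hreg τ (c₀ := c₀) (c₁ := c₁) hpos (covDerivL2K ℂ c₀ ((η : ℂ))⁻¹ (adTransportW φ U) (RofUk L m n φ η U (c₀ := c₀) s))
      = covDerivL2K ℂ c₀ ((η : ℂ))⁻¹ (adTransportW φ U) (GpOfUk L m n φ η U a' (c₁ := c₁) hpos' (RofUk L m n φ η U (c₀ := c₀) s))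
        - G1k L m n φ η U hL αU hα1 hU1 hreg τ (c₀ := c₀) (c₁ := c₁) hpos (hessOp φ η U τ (covDerivL2K ℂ c₀ ((η : ℂ))⁻¹ (adTransportW φ U)
            (GpOfUk L m n φ η U a' (c₁ := c₁) hpos' (RofUk L m n φ η U (c₀ := c₀) s)))) := fun s =>
    G1k_covDerivL2K_RofUk L m n φ η U a' hpos' hL αU hα1 hU1 hreg τ a hpos s
  have h30 : ∀ s, covDivL2K ℂ c₀ ((η : ℂ))⁻¹ (adTransportW φ fun bb => (U bb)⁻¹) (covDerivL2K ℂ c₀ ((η : ℂ))⁻¹ (adTransportW φ U)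
      (GpOfUk L m n φ η U a' (c₁ := c₁) hpos' (RofUk L m n φ η U (c₀ := c₀) s))) = RofUk L m n φ η U (c₀ := c₀) s := fun s =>
    covDivL2K_covDerivL2K_GpOfUk_RofUk L m n φ η U a' hpos' s
  have hT' : ∀ g, Gt g = G0cl g + G0cl (Mcl (Gpcl (Rcl (Dscl (Gt g))))) + G0cl (Dcl (Rcl (Gpcl (Mtcl (Gt g - Dcl (Gpcl (Rcl (Dscl (Gt g))))))))) := by
    intro g; simp only [eG0, eD, eDs, eM, eMt, eGp, eR]; exact hT0 g
  have h2' : ∀ s, G0cl (Dcl (Rcl s)) = Dcl (Gpcl (Rcl s)) - G0cl (Mcl (Gpcl (Rcl s))) := by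
    intro s; simp only [eG0, eD, eM, eGp, eR]; exact h20 s
  have h3' : ∀ s, Dscl (Dcl (Gpcl (Rcl s))) = Rcl s := by
    intro s; simp only [eD, eDs, eGp, eR]; exact h30 s
  have hG0L : ∀ (v : TSite d m) (g : BondL2K ℂ d (towerP L m (n + 1)) c₀ W) (F : ℝ),
      (∀ x, blockCoord (L ^ (n + 1)) m (siteCast (towerP_eq_fineP_pow L m (n + 1)) (bpos x)) ≠ v →
        WL2.equiv ℂ (fun _ : Bond d (towerP L m (n + 1)) => c₀) W g x = 0) →
      (∀ x, ‖WL2.equiv ℂ (fun _ : Bond d (towerP L m (n + 1)) => c₀) W g x‖ ≤ F) →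
      ∀ x, ‖WL2.equiv ℂ (fun _ : Bond d (towerP L m (n + 1)) => c₀) W (G0cl g) x‖ ≤
        BK * Real.exp (-(κ * tdist m (blockCoord (L ^ (n + 1)) m (siteCast (towerP_eq_fineP_pow L m (n + 1)) (bpos x))) v)) * F := by
    intro v g F hgv hgF x
    have hF : 0 ≤ F := (norm_nonneg _).trans (hgF x)
    rw [eG0]
    exact (HK n η hηL c₀ c₁ hw hρ m hm U αU hα0 hα1 hU1 hreg εU hεU hUε hLb α hα hαK_ hUst hUb hUη hpl hUgrad hRlev hεg hAQ hpos' hpos v g F hgv hgF x).trans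
      (mul_le_mul_of_nonneg_right (mul_le_mul_of_nonneg_left (exp_weaken' hκK (tdist_nonneg m _ _)) hBK) hF)
  have hDsG0L : ∀ (v : TSite d m) (g : BondL2K ℂ d (towerP L m (n + 1)) c₀ W) (F : ℝ),
      (∀ x, blockCoord (L ^ (n + 1)) m (siteCast (towerP_eq_fineP_pow L m (n + 1)) (bpos x)) ≠ v →
        WL2.equiv ℂ (fun _ : Bond d (towerP L m (n + 1)) => c₀) W g x = 0) →
      (∀ x, ‖WL2.equiv ℂ (fun _ : Bond d (towerP L m (n + 1)) => c₀) W g x‖ ≤ F) →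
      ∀ x, ‖WL2.equiv ℂ (fun _ : TSite d (towerP L m (n + 1)) => c₀) W (Dscl (G0cl g)) x‖ ≤
        BG1 * Real.exp (-(κ * tdist m (blockCoord (L ^ (n + 1)) m (siteCast (towerP_eq_fineP_pow L m (n + 1)) x)) v)) * F := by
    intro v g F hgv hgF x
    have hF : 0 ≤ F := (norm_nonneg _).trans (hgF b)
    rw [eDs, eG0]
    exact (HG n η hηL c₀ c₁ hw hρ m hm U αU hα0 hα1 hU1 hreg εU hεU hUε hLb α hα hαG_ hUst hUb hUη hpl hUgrad hRlev hεg hAQ hpos' hpos v g F hgv hgF x).trans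
      (mul_le_mul_of_nonneg_right (mul_le_mul_of_nonneg_left (exp_weaken' hκG (tdist_nonneg m _ _)) hBG1) hF)
  have hGpL : ∀ (v : TSite d m) (s : SiteL2K ℂ d (towerP L m (n + 1)) c₀ W) (F : ℝ),
      (∀ x, blockCoord (L ^ (n + 1)) m (siteCast (towerP_eq_fineP_pow L m (n + 1)) x) ≠ v →
        WL2.equiv ℂ (fun _ : TSite d (towerP L m (n + 1)) => c₀) W s x = 0) →
      (∀ x, ‖WL2.equiv ℂ (fun _ : TSite d (towerP L m (n + 1)) => c₀) W s x‖ ≤ F) →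
      ∀ x, ‖WL2.equiv ℂ (fun _ : TSite d (towerP L m (n + 1)) => c₀) W (Gpcl s) x‖ ≤
        BR * Real.exp (-(κ * tdist m (blockCoord (L ^ (n + 1)) m (siteCast (towerP_eq_fineP_pow L m (n + 1)) x)) v)) * F := by
    intro v s F hsv hsF x
    have hF : 0 ≤ F := (norm_nonneg _).trans (hsF x)
    rw [eGp]
    exact (HR n η hηL c₀ c₁ hw hρ m hm U αU hα0 hα1 hU1 hreg εU hεU hUε hLb α hα hαR_ hUst hUb hUη hpl hUgrad hRlev hεg hAQ hpos' v s F hsv hsF x).1.trans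
      (mul_le_mul_of_nonneg_right (mul_le_mul_of_nonneg_left (exp_weaken' hκR (tdist_nonneg m _ _)) hBR) hF)
  have hRL : ∀ (v : TSite d m) (s : SiteL2K ℂ d (towerP L m (n + 1)) c₀ W) (F : ℝ),
      (∀ x, blockCoord (L ^ (n + 1)) m (siteCast (towerP_eq_fineP_pow L m (n + 1)) x) ≠ v →
        WL2.equiv ℂ (fun _ : TSite d (towerP L m (n + 1)) => c₀) W s x = 0) →
      (∀ x, ‖WL2.equiv ℂ (fun _ : TSite d (towerP L m (n + 1)) => c₀) W s x‖ ≤ F) →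
      ∀ x, ‖WL2.equiv ℂ (fun _ : TSite d (towerP L m (n + 1)) => c₀) W (Rcl s) x‖ ≤
        BR * Real.exp (-(κ * tdist m (blockCoord (L ^ (n + 1)) m (siteCast (towerP_eq_fineP_pow L m (n + 1)) x)) v)) * F := by
    intro v s F hsv hsF x
    have hF : 0 ≤ F := (norm_nonneg _).trans (hsF x)
    rw [eR]
    exact (HR n η hηL c₀ c₁ hw hρ m hm U αU hα0 hα1 hU1 hreg εU hεU hUε hLb α hα hαR_ hUst hUb hUη hpl hUgrad hRlev hεg hAQ hpos' v s F hsv hsF x).2.1.trans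
      (mul_le_mul_of_nonneg_right (mul_le_mul_of_nonneg_left (exp_weaken' hκR (tdist_nonneg m _ _)) hBR) hF)
  have hDGRL : ∀ (v : TSite d m) (s : SiteL2K ℂ d (towerP L m (n + 1)) c₀ W) (F : ℝ),
      (∀ x, blockCoord (L ^ (n + 1)) m (siteCast (towerP_eq_fineP_pow L m (n + 1)) x) ≠ v →
        WL2.equiv ℂ (fun _ : TSite d (towerP L m (n + 1)) => c₀) W s x = 0) →
      (∀ x, ‖WL2.equiv ℂ (fun _ : TSite d (towerP L m (n + 1)) => c₀) W s x‖ ≤ F) →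
      ∀ x, ‖WL2.equiv ℂ (fun _ : Bond d (towerP L m (n + 1)) => c₀) W (Dcl (Gpcl (Rcl s))) x‖ ≤
        BDb * Real.exp (-(κ * tdist m (blockCoord (L ^ (n + 1)) m (siteCast (towerP_eq_fineP_pow L m (n + 1)) (bpos x))) v)) * F := by
    intro v s F hsv hsF x
    have hF : 0 ≤ F := (norm_nonneg _).trans (hsF b.1)
    rw [eD, eGp, eR]
    have h := HD n η hηL c₀ c₁ hw hρ m hm U αU hα0 hα1 hU1 hreg εU hεU hUε hLb α hα hαD_ hUst hUb hUη hpl hUgrad hRlev hεg hAQ hpos' v s F hsv hsF x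
    have htri : tdist m (blockCoord (L ^ (n + 1)) m (siteCast (towerP_eq_fineP_pow L m (n + 1)) (bpos x))) v ≤
        tdist m (blockCoord (L ^ (n + 1)) m (siteCast (towerP_eq_fineP_pow L m (n + 1)) (btgt x))) v + 1 := by
      have h1 := tdist_triangle hm (blockCoord (L ^ (n + 1)) m (siteCast (towerP_eq_fineP_pow L m (n + 1)) (bpos x)))
        (blockCoord (L ^ (n + 1)) m (siteCast (towerP_eq_fineP_pow L m (n + 1)) (btgt x))) v
      have h2 := tdist_bigBlock_bpos_btgt_le_one L m (n + 1) hm x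
      linarith only [h1, h2]
    calc _ ≤ BD * Real.exp (-(δD * tdist m (blockCoord (L ^ (n + 1)) m (siteCast (towerP_eq_fineP_pow L m (n + 1)) (btgt x))) v)) * F := h
      _ ≤ BD * Real.exp (-(κ * tdist m (blockCoord (L ^ (n + 1)) m (siteCast (towerP_eq_fineP_pow L m (n + 1)) (btgt x))) v)) * F :=
          mul_le_mul_of_nonneg_right (mul_le_mul_of_nonneg_left (exp_weaken' hκD (tdist_nonneg m _ _)) hBD) hF
      _ ≤ BD * (Real.exp κ * Real.exp (-(κ * tdist m (blockCoord (L ^ (n + 1)) m (siteCast (towerP_eq_fineP_pow L m (n + 1)) (bpos x))) v))) * F :=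
          mul_le_mul_of_nonneg_right (mul_le_mul_of_nonneg_left (exp_reblock hκ0.le htri) hBD) hF
      _ = BDb * Real.exp (-(κ * tdist m (blockCoord (L ^ (n + 1)) m (siteCast (towerP_eq_fineP_pow L m (n + 1)) (bpos x))) v)) * F := by
          rw [hBDb]; ring
  have hML : ∀ (v : TSite d m) (s : SiteL2K ℂ d (towerP L m (n + 1)) c₀ W) (F : ℝ),
      (∀ x, blockCoord (L ^ (n + 1)) m (siteCast (towerP_eq_fineP_pow L m (n + 1)) x) ≠ v →
        WL2.equiv ℂ (fun _ : TSite d (towerP L m (n + 1)) => c₀) W s x = 0) →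
      (∀ x, ‖WL2.equiv ℂ (fun _ : TSite d (towerP L m (n + 1)) => c₀) W s x‖ ≤ F) →
      ∀ x, ‖WL2.equiv ℂ (fun _ : Bond d (towerP L m (n + 1)) => c₀) W (Mcl s) x‖ ≤
        (2 * Mφ * Mφ' * j₀ * Real.exp κ) *
          Real.exp (-(κ * tdist m (blockCoord (L ^ (n + 1)) m (siteCast (towerP_eq_fineP_pow L m (n + 1)) (bpos x))) v)) * F := by
    intro v s F hsv hsF x
    rw [eM]
    exact local_hessOp_covDerivL2K_tower L m (n + 1) φ τ hτ₂ hφτ hη hUst hc₀η hUb hMφ hMφ' hφ hφ' hJ hm hκ0.le v s F hsv hsF x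
  have hMtL : ∀ (v : TSite d m) (g : BondL2K ℂ d (towerP L m (n + 1)) c₀ W) (F : ℝ),
      (∀ x, blockCoord (L ^ (n + 1)) m (siteCast (towerP_eq_fineP_pow L m (n + 1)) (bpos x)) ≠ v →
        WL2.equiv ℂ (fun _ : Bond d (towerP L m (n + 1)) => c₀) W g x = 0) →
      (∀ x, ‖WL2.equiv ℂ (fun _ : Bond d (towerP L m (n + 1)) => c₀) W g x‖ ≤ F) →
      ∀ x, ‖WL2.equiv ℂ (fun _ : TSite d (towerP L m (n + 1)) => c₀) W (Mtcl g) x‖ ≤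
        (2 * d * Mφ * Mφ' * j₀ * Real.exp κ) *
          Real.exp (-(κ * tdist m (blockCoord (L ^ (n + 1)) m (siteCast (towerP_eq_fineP_pow L m (n + 1)) x)) v)) * F := by
    intro v g F hgv hgF x
    rw [eMt]
    exact local_covDivL2K_hessOp_tower L m (n + 1) φ τ hτ₂ hφτ hη hUst hc₀η hUb hMφ hMφ' hφ hφ' hJ hm hκ0.le v g F hgv hgF x
  have hSL : ∀ w' : TSite d m, ∑ u : TSite d m, Real.exp (-((κ - κ / 2) * tdist m w' u)) ≤ K := fun w' => by
    rw [hKdef]; exact torusSum_le d hm (sub_pos.2 (half_lt_self hκ0)) w'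
  have hε₁0 : 0 ≤ 2 * Mφ * Mφ' * j₀ * Real.exp κ :=
    mul_nonneg (mul_nonneg (mul_nonneg (mul_nonneg zero_le_two hMφ) hMφ') hj₀0) (Real.exp_nonneg _)
  have hε₂0 : 0 ≤ 2 * d * Mφ * Mφ' * j₀ * Real.exp κ :=
    mul_nonneg (mul_nonneg (mul_nonneg (mul_nonneg (mul_nonneg zero_le_two (Nat.cast_nonneg d)) hMφ) hMφ') hj₀0) (Real.exp_nonneg _)
  have hT1 : ∀ (v : TSite d m) (g : BondL2K ℂ d (towerP L m (n + 1)) c₀ W) (F : ℝ),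
      (∀ x, blockCoord (L ^ (n + 1)) m (siteCast (towerP_eq_fineP_pow L m (n + 1)) (bpos x)) ≠ v →
        WL2.equiv ℂ (fun _ : Bond d (towerP L m (n + 1)) => c₀) W g x = 0) →
      (∀ x, ‖WL2.equiv ℂ (fun _ : Bond d (towerP L m (n + 1)) => c₀) W g x‖ ≤ F) →
      ∀ x, ‖WL2.equiv ℂ (fun _ : Bond d (towerP L m (n + 1)) => c₀) W (Gt g) x‖ ≤
        BT * Real.exp (-(κ / 2 * tdist m (blockCoord (L ^ (n + 1)) m (siteCast (towerP_eq_fineP_pow L m (n + 1)) (bpos x))) v)) * F := by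
    intro v g F hgv hgF x
    have hF : 0 ≤ F := (norm_nonneg _).trans (hgF x)
    rw [eGt]
    exact (HT n η hηL c₀ c₁ hw hρ m hm U αU hα0 hα1 hU1 hreg εU hεU hUε hLb α hα hαT_ hUst hUb hUη hpl hUgrad hRlev hεg hAQ hpos' hpos hc₀η j₀ hJ hjT_
      hposπ v g F hgv hgF x x.1).1.trans
      (mul_le_mul_of_nonneg_right (mul_le_mul_of_nonneg_left (exp_weaken' hκT2 (tdist_nonneg m _ _)) hBT) hF)
  have hT2 : ∀ (v : TSite d m) (g : BondL2K ℂ d (towerP L m (n + 1)) c₀ W) (F : ℝ),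
      (∀ x, blockCoord (L ^ (n + 1)) m (siteCast (towerP_eq_fineP_pow L m (n + 1)) (bpos x)) ≠ v →
        WL2.equiv ℂ (fun _ : Bond d (towerP L m (n + 1)) => c₀) W g x = 0) →
      (∀ x, ‖WL2.equiv ℂ (fun _ : Bond d (towerP L m (n + 1)) => c₀) W g x‖ ≤ F) →
      ∀ x, ‖WL2.equiv ℂ (fun _ : TSite d (towerP L m (n + 1)) => c₀) W (Dscl (Gt g)) x‖ ≤
        BT * Real.exp (-(κ / 2 * tdist m (blockCoord (L ^ (n + 1)) m (siteCast (towerP_eq_fineP_pow L m (n + 1)) x)) v)) * F := by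
    intro v g F hgv hgF x
    have hF : 0 ≤ F := (norm_nonneg _).trans (hgF b)
    rw [eDs, eGt]
    exact (HT n η hηL c₀ c₁ hw hρ m hm U αU hα0 hα1 hU1 hreg εU hεU hUε hLb α hα hαT_ hUst hUb hUη hpl hUgrad hRlev hεg hAQ hpos' hpos hc₀η j₀ hJ hjT_
      hposπ v g F hgv hgF b x).2.trans
      (mul_le_mul_of_nonneg_right (mul_le_mul_of_nonneg_left (exp_weaken' hκT2 (tdist_nonneg m _ _)) hBT) hF)
  have hdiff := transfer_pair_diff (𝕜 := ℂ) (tdist m)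
    (fun x : Bond d (towerP L m (n + 1)) => blockCoord (L ^ (n + 1)) m (siteCast (towerP_eq_fineP_pow L m (n + 1)) (bpos x)))
    (fun x : TSite d (towerP L m (n + 1)) => blockCoord (L ^ (n + 1)) m (siteCast (towerP_eq_fineP_pow L m (n + 1)) x))
    G0cl Gt Dcl Mcl Dscl Mtcl Gpcl Rcl (tdist_nonneg m) (fun u y' w' => tdist_triangle hm u y' w') hT' h2' h3'
    hBK hBG1 hBR hBR hBDb0 hε₁0 hε₂0 (half_pos hκ0).le hBT hG0L hDsG0L hGpL hRL hDGRL hML hMtL hSL hT1 hT2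
  have hsq : j₀ ^ 2 ≤ j₀ := by rw [sq]; exact mul_le_of_le_one_right hj₀0 hj₀1
  have e₁ : BR * K * BR * K * (2 * Mφ * Mφ' * j₀ * Real.exp κ) * K * BK * K + (2 * d * Mφ * Mφ' * j₀ * Real.exp κ) * K * BR * K * BDb * K +
        BDb * K * (2 * d * Mφ * Mφ' * j₀ * Real.exp κ) * K * BR * K * BDb * K +
        (2 * d * Mφ * Mφ' * j₀ * Real.exp κ) * K * BR * K * BR * K * BR * K * (2 * Mφ * Mφ' * j₀ * Real.exp κ) * K * BK * K +
        BDb * K * (2 * d * Mφ * Mφ' * j₀ * Real.exp κ) * K * BR * K * BR * K * BR * K * (2 * Mφ * Mφ' * j₀ * Real.exp κ) * K * BK * K = j₀ * A₁ + j₀ ^ 2 * A₂ := by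
    rw [hA₁, hA₂, he1, he2]; ring
  have e₂ : BR * K * BR * K * (2 * Mφ * Mφ' * j₀ * Real.exp κ) * K * BG1 * K + (2 * d * Mφ * Mφ' * j₀ * Real.exp κ) * K * BR * K * BR * K +
        BDb * K * (2 * d * Mφ * Mφ' * j₀ * Real.exp κ) * K * BR * K * BR * K +
        (2 * d * Mφ * Mφ' * j₀ * Real.exp κ) * K * BR * K * BR * K * BR * K * (2 * Mφ * Mφ' * j₀ * Real.exp κ) * K * BG1 * K +
        BDb * K * (2 * d * Mφ * Mφ' * j₀ * Real.exp κ) * K * BR * K * BR * K * BR * K * (2 * Mφ * Mφ' * j₀ * Real.exp κ) * K * BG1 * K = j₀ * A₃ + j₀ ^ 2 * A₄ := by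
    rw [hA₃, hA₄, he1, he2]; ring
  have hb₁ : (j₀ * A₁ + j₀ ^ 2 * A₂) * BT ≤ j₀ * C := by
    have h1 : j₀ * A₁ + j₀ ^ 2 * A₂ ≤ j₀ * (A₁ + A₂ + A₃ + A₄) := by nlinarith only [hsq, hA₁0, hA₂0, hA₃0, hA₄0, hj₀0]
    calc (j₀ * A₁ + j₀ ^ 2 * A₂) * BT ≤ j₀ * (A₁ + A₂ + A₃ + A₄) * BT := mul_le_mul_of_nonneg_right h1 hBT
      _ = j₀ * C := by rw [hC]; ring
  have hb₂ : (j₀ * A₃ + j₀ ^ 2 * A₄) * BT ≤ j₀ * C := by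
    have h1 : j₀ * A₃ + j₀ ^ 2 * A₄ ≤ j₀ * (A₁ + A₂ + A₃ + A₄) := by nlinarith only [hsq, hA₁0, hA₂0, hA₃0, hA₄0, hj₀0]
    calc (j₀ * A₃ + j₀ ^ 2 * A₄) * BT ≤ j₀ * (A₁ + A₂ + A₃ + A₄) * BT := mul_le_mul_of_nonneg_right h1 hBT
      _ = j₀ * C := by rw [hC]; ring
  refine ⟨?_, ?_⟩
  · have h := hdiff.1 v f F hfv hfF b
    have e : WL2.equiv ℂ (fun _ : Bond d (towerP L m (n + 1)) => c₀) W ((Gt - G0cl) f) b =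
        WL2.equiv ℂ (fun _ : Bond d (towerP L m (n + 1)) => c₀) W (G1LatticeK hposπ f - G1k L m n φ η U hL αU hα1 hU1 hreg τ (c₀ := c₀) (c₁ := c₁) hpos f) b := by rw [← eGt f, ← eG0 f]; rfl
    rw [e] at h
    exact h.trans (mul_le_mul_of_nonneg_right (mul_le_mul_of_nonneg_right ((mul_le_mul_of_nonneg_right e₁.le hBT).trans hb₁) (Real.exp_nonneg _)) hF0)
  · have h := hdiff.2 v f F hfv hfF y
    have e : WL2.equiv ℂ (fun _ : TSite d (towerP L m (n + 1)) => c₀) W ((Dscl ∘L Gt - Dscl ∘L G0cl) f) y =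
        WL2.equiv ℂ (fun _ : TSite d (towerP L m (n + 1)) => c₀) W (covDivL2K ℂ c₀ ((η : ℂ))⁻¹ (adTransportW φ fun bb => (U bb)⁻¹) (G1LatticeK hposπ f) - covDivL2K ℂ c₀ ((η : ℂ))⁻¹ (adTransportW φ fun bb => (U bb)⁻¹) (G1k L m n φ η U hL αU hα1 hU1 hreg τ (c₀ := c₀) (c₁ := c₁) hpos f)) y := by
      rw [← eGt f, ← eG0 f, ← eDs, ← eDs]; rfl
    rw [e] at h
    exact h.trans (mul_le_mul_of_nonneg_right (mul_le_mul_of_nonneg_right ((mul_le_mul_of_nonneg_right e₂.le hBT).trans hb₂) (Real.exp_nonneg _)) hF0)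

end Literature.MathematicalPhysics.QuantumFieldTheory.Balaban1983to89.B9Eq3130GtildeMinusG1kRowsClosed

end
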